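import Summits.HodgeConjecture.CorCM.Census.CentralSquaresTransversal

/-!
# The square-central class, XIV: star normal forms at the TIE CORNERS of level three (the `m = 2` building blocks)

COR-CM (cell `pub-hodgecm2`), count-neutral kernel combinatorics by the binder seat b09 (gen 45; lane SQUARE-CENTRAL CLASS, part XIV), on parts III–IV
(`bpot_eq_card_dev_of_le`, `unique_T₀_of_lt`, `face_toward_T₀`, `card_symmDiff_union`) and gen 32ʼs `single_sub_thetaG_mem_of`, BY NAME.  Theorems only; no `decide`,
no certificate, no named fact, no `sorry`.  HONEST FRAMING: `HC_CM` is NOT proved, here or anywhere in the tree; nothing here is a period or a headline.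

In the four-type frame (`T₀`, `T₁`, `𝓗 = T₀ ∖ T₁` of size `2m`, `|T₀| = 4m`, base block `{T₀, T̄₀, T₁, T̄₁}`, `m ≥ 2`) the `m = 2` rows (`D₄ × ℤ/2`, `G(16,3)`; design note
`CENTRAL-SQUARES.md` §4) need star normal forms at types that are NOT in a strict Voronoi cell: the corners `⟨p, q, q'⟩` of the designated pair face, with one
deviation place `p` on one side of `𝓗` and two places `q, q'` on the other — ties between `T₀` and `T̄₁` (resp. `T₁`).  This file provides the direction-`T₀` half:
* `unique_T₀_of_mixed_pair`: a type with a MIXED two-element deviation set (one place in `𝓗`, one outside) has `T₀` as its unique nearest base change (`m ≥ 2`);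
* `single_sub_thetaG_mem_mixed_pair`: hence its star normal form `[Y] − θ_{T₀}(typeSum [Y]) ∈ L` from any strict lowering cover;
* `single_sub_thetaG_mem_tie_corner`: if the face of `X = ⟨p, q, q'⟩` with places `q, q'` lies in `L`, then `[X] − θ_{T₀}(typeSum [X]) ∈ L` (both shapes at once:
  `p ∈ 𝓗, q, q' ∉ 𝓗` and `p ∉ 𝓗, q, q' ∈ 𝓗`).
The other direction (toward `T̄₁`, resp. `T₁`) is the same statement in the exchanged frames of parts V/VII.

## References
* [Pohlmann1968] H. Pohlmann, Algebraic cycles on abelian varieties of complex multiplication type, Ann. of Math. 88 (1968), Thm 1.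
* [Milne1999] J. S. Milne, Lefschetz motives and the Tate conjecture, Compositio Math. 117 (1999), Prop. 2.1, p. 54.
-/

namespace Summit.HodgeConjecture.CorCM.Census.CentralSquares

open Finset
open scoped symmDiff
open Summit.HodgeConjecture.CorCM.Prior.AllgGroup.RfwfAllgGroup
open Summit.HodgeConjecture.CorCM.Census.BlockParity
open Summit.HodgeConjecture.CorCM.Census.Coinvariant
open Summit.HodgeConjecture.CorCM.Census.TwistGeneration
open Summit.HodgeConjecture.CorCM.Census.BaseBlock
open Summit.HodgeConjecture.CorCM.Census.CoverClosure

noncomputable section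

variable {G : Type*} [Group G] [Fintype G] [DecidableEq G] (c : G)

section Frame

variable (hc2 : c * c = 1) (hcen : ∀ x : G, x * c = c * x) (T₀ T₁ : CMF G c)
variable (hbase : ∀ Q : G, rt c Q T₀ = T₀ ∨ rt c Q T₀ = rt c c T₀ ∨ rt c Q T₀ = T₁ ∨ rt c Q T₀ = rt c c T₁)
variable (m : ℕ) (hn : T₀.1.card = 4 * m) (hH : (T₀.1 \ T₁.1).card = 2 * m)
variable (L : Submodule ℤ (CMF G c →₀ ℤ))
variable (hcover : ∀ Ψ : CMF G c, 2 ≤ bpot c T₀ Ψ → ∃ Q₂ s s' : G, bpot c T₀ Ψ = ddist (rt c Q₂ T₀) Ψ ∧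
    s ∈ (rt c Q₂ T₀).1 \ Ψ.1 ∧ s' ∈ (rt c Q₂ T₀).1 \ Ψ.1 ∧ s ≠ s' ∧
    gface c hc2 Ψ s s' ∈ L ∧
    ((∃ Q₁ t t' : G, bpot c T₀ Ψ = ddist (rt c Q₁ T₀) Ψ ∧ t ∈ (rt c Q₁ T₀).1 \ Ψ.1 ∧ t' ∈ (rt c Q₁ T₀).1 \ Ψ.1 ∧ t ≠ t' ∧
        (∀ Q' : G, ddist (rt c Q' T₀) (oflipCM c hc2 t Ψ) = bpot c T₀ (oflipCM c hc2 t Ψ) → rt c Q' T₀ = rt c Q₁ T₀) ∧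
        (∀ Q' : G, ddist (rt c Q' T₀) (oflipCM c hc2 t' Ψ) = bpot c T₀ (oflipCM c hc2 t' Ψ) → rt c Q' T₀ = rt c Q₁ T₀) ∧
        (∀ Q' : G, ddist (rt c Q' T₀) (oflipCM c hc2 t (oflipCM c hc2 t' Ψ)) = bpot c T₀ (oflipCM c hc2 t (oflipCM c hc2 t' Ψ)) →
          rt c Q' T₀ = rt c Q₁ T₀)) →
      (∀ Q' : G, ddist (rt c Q' T₀) (oflipCM c hc2 s Ψ) = bpot c T₀ (oflipCM c hc2 s Ψ) → rt c Q' T₀ = rt c Q₂ T₀) ∧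
      (∀ Q' : G, ddist (rt c Q' T₀) (oflipCM c hc2 s' Ψ) = bpot c T₀ (oflipCM c hc2 s' Ψ) → rt c Q' T₀ = rt c Q₂ T₀) ∧
      (∀ Q' : G, ddist (rt c Q' T₀) (oflipCM c hc2 s (oflipCM c hc2 s' Ψ)) = bpot c T₀ (oflipCM c hc2 s (oflipCM c hc2 s' Ψ)) →
        rt c Q' T₀ = rt c Q₂ T₀)))

/-! ## §1 Mixed pairs: unique nearest base change `T₀` -/

include hH in
/-- For a MIXED pair `{p, r} ⊆ T₀` (exactly one of the two places in `𝓗 = T₀ ∖ T₁`): `|𝓗 ∆ {p, r}| = 2m`. [folklore] -/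
theorem card_symmDiff_mixed_pair {p r : G} (hp0 : p ∈ T₀.1) (hr0 : r ∈ T₀.1) (hside : p ∈ T₁.1 ↔ r ∉ T₁.1) :
    ((T₀.1 \ T₁.1) ∆ ({p, r} : Finset G)).card = 2 * m := by
  by_cases hp1 : p ∈ T₁.1
  · -- `p ∉ 𝓗`, `r ∈ 𝓗`
    have hr1 : r ∉ T₁.1 := hside.mp hp1
    have e : ({p, r} : Finset G) = {r} ∪ {p} := by
      ext x; simp only [mem_insert, mem_singleton, mem_union]; tauto
    have hpos : 1 ≤ (T₀.1 \ T₁.1).card := card_pos.mpr ⟨r, mem_sdiff.mpr ⟨hr0, hr1⟩⟩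
    rw [hH] at hpos
    rw [e, card_symmDiff_union _ {r} {p} (singleton_subset_iff.mpr (mem_sdiff.mpr ⟨hr0, hr1⟩))
      (disjoint_singleton_left.mpr fun h => (mem_sdiff.mp h).2 hp1), hH, card_singleton, card_singleton]
    omega
  · have hr1 : r ∈ T₁.1 := by by_contra h; exact hp1 (hside.mpr h)
    have e : ({p, r} : Finset G) = {p} ∪ {r} := by
      ext x; simp only [mem_insert, mem_singleton, mem_union]
    have hpos : 1 ≤ (T₀.1 \ T₁.1).card := card_pos.mpr ⟨p, mem_sdiff.mpr ⟨hp0, hp1⟩⟩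
    rw [hH] at hpos
    rw [e, card_symmDiff_union _ {p} {r} (singleton_subset_iff.mpr (mem_sdiff.mpr ⟨hp0, hp1⟩))
      (disjoint_singleton_left.mpr fun h => (mem_sdiff.mp h).2 hr1), hH, card_singleton, card_singleton]
    omega

include hc2 hcen hbase hn hH in
/-- **A mixed pair has `T₀` as its unique nearest base change** (`m ≥ 2`): a type `Y` with deviation set `{p, r}`, exactly one of `p, r` in `𝓗`, has
`bpot Y = 2` and every nearest base change equal to `T₀`. [folklore] -/
theorem unique_T₀_of_mixed_pair (hm : 2 ≤ m) {p r : G} (hp0 : p ∈ T₀.1) (hr0 : r ∈ T₀.1) (hpr : p ≠ r) (hside : p ∈ T₁.1 ↔ r ∉ T₁.1)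
    (Y : CMF G c) (hY : T₀.1 \ Y.1 = {p, r}) :
    bpot c T₀ Y = 2 ∧ ∀ Q' : G, ddist (rt c Q' T₀) Y = bpot c T₀ Y → rt c Q' T₀ = rt c (1 : G) T₀ := by
  have hcard : (T₀.1 \ Y.1).card = 2 := by rw [hY, card_pair hpr]
  have hsd : ((T₀.1 \ T₁.1) ∆ (T₀.1 \ Y.1)).card = 2 * m := by rw [hY]; exact card_symmDiff_mixed_pair c T₀ T₁ m hH hp0 hr0 hside
  have h1 : (T₀.1 \ Y.1).card < T₀.1.card - (T₀.1 \ Y.1).card := by rw [hcard, hn]; omega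
  have h2 : (T₀.1 \ Y.1).card < ((T₀.1 \ T₁.1) ∆ (T₀.1 \ Y.1)).card := by rw [hcard, hsd]; omega
  have h3 : (T₀.1 \ Y.1).card < T₀.1.card - ((T₀.1 \ T₁.1) ∆ (T₀.1 \ Y.1)).card := by rw [hcard, hsd, hn]; omega
  refine ⟨?_, unique_T₀_of_lt c T₀ T₁ hbase hc2 hcen Y h1 h2 h3⟩
  rw [← hcard]; exact bpot_eq_card_dev_of_le c T₀ T₁ hbase hc2 hcen Y h1.le h2.le h3.le

include hcen hbase hn hH hcover in
/-- **STAR NORMAL FORM OF A MIXED PAIR** (`m ≥ 2`): every type whose deviation set is contained in a mixed pair `{p, r}` satisfies `[Y] − θ_{T₀}(typeSum [Y]) ∈ L`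
for any strict lowering cover feeding `L`. [folklore] -/
theorem single_sub_thetaG_mem_mixed_pair (hm : 2 ≤ m) {p r : G} (hp0 : p ∈ T₀.1) (hr0 : r ∈ T₀.1) (hpr : p ≠ r)
    (hside : p ∈ T₁.1 ↔ r ∉ T₁.1) :
    ∀ Y : CMF G c, T₀.1 \ Y.1 ⊆ {p, r} → Finsupp.single Y 1 - thetaG c hc2 T₀ (typeSum G c (Finsupp.single Y 1)) ∈ L := by
  refine single_sub_thetaG_mem_of c T₀ (fun Y => T₀.1 \ Y.1 ⊆ {p, r}) hc2 L fun Y hY h2 => ?_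
  -- the deviation set is the whole pair
  have hle : ({p, r} : Finset G).card ≤ (T₀.1 \ Y.1).card := by rw [card_pair hpr]; exact h2
  have hdev : T₀.1 \ Y.1 = {p, r} := eq_of_subset_of_card_le hY hle
  obtain ⟨hbp, huniq⟩ := unique_T₀_of_mixed_pair c hc2 hcen T₀ T₁ hbase m hn hH hm hp0 hr0 hpr hside Y hdev
  obtain ⟨s, s', hs, hs', hss', hmem⟩ := face_toward_T₀ c hc2 T₀ L hcover Y (by rw [hbp]) huniq
  have hcorner : ∀ s ∈ T₀.1 \ Y.1, T₀.1 \ (oflipCM c hc2 s Y).1 ⊆ {p, r} := fun s hs =>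
    (dev_oflip c hc2 (mem_sdiff.mp hs).1 (mem_sdiff.mp hs).2).symm ▸ (erase_subset _ _).trans hY
  refine ⟨s, s', hs, hs', hss', hmem, hcorner s hs, hcorner s' hs', ?_⟩
  have hs'' : s ∈ T₀.1 \ (oflipCM c hc2 s' Y).1 := by
    rw [dev_oflip c hc2 (mem_sdiff.mp hs').1 (mem_sdiff.mp hs').2]; exact mem_erase.mpr ⟨hss', hs⟩
  exact (dev_oflip c hc2 (mem_sdiff.mp hs'').1 (mem_sdiff.mp hs'').2).symm ▸ (erase_subset _ _).trans (hcorner s' hs')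

/-! ## §2 The tie corner `⟨p, q, q'⟩` with its face toward `T₀` -/

include hcen hbase hn hH hcover in
/-- **STAR NORMAL FORM AT A TIE CORNER, direction `T₀`** (`m ≥ 2`).  Let `X` have deviation set `{p, q, q'}` with `q ≠ q'` on one side of `𝓗` and `p` on the
other (`p ∈ 𝓗 ↔ q ∉ 𝓗`, `q ∈ 𝓗 ↔ q' ∈ 𝓗`).  If the face of `X` with places `q, q'` lies in `L`, then every type `Y` with `D(Y) ⊆ {p, q, q'}` and
`p ∈ D(Y)` whenever `|D(Y)| ≥ 2` — in particular `X` itself and the mixed corners `⟨p, q⟩`, `⟨p, q'⟩` — satisfies `[Y] − θ_{T₀}(typeSum [Y]) ∈ L`.  (The excluded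
sub-type `⟨q, q'⟩` is a tie at `m = 2` and is never visited.) [folklore] -/
theorem single_sub_thetaG_mem_tie_corner (hm : 2 ≤ m) {p q q' : G} (hp0 : p ∈ T₀.1) (hq0 : q ∈ T₀.1) (hq0' : q' ∈ T₀.1)
    (hqq' : q ≠ q') (hpq : p ∈ T₁.1 ↔ q ∉ T₁.1) (hpq' : p ∈ T₁.1 ↔ q' ∉ T₁.1)
    (X : CMF G c) (hX : T₀.1 \ X.1 = {p, q, q'}) (hface : gface c hc2 X q q' ∈ L) :
    ∀ Y : CMF G c, T₀.1 \ Y.1 ⊆ {p, q, q'} → (2 ≤ (T₀.1 \ Y.1).card → p ∈ T₀.1 \ Y.1) →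
      Finsupp.single Y 1 - thetaG c hc2 T₀ (typeSum G c (Finsupp.single Y 1)) ∈ L := by
  have hpq0 : p ≠ q := fun h => by rw [h] at hpq; exact iff_not_self hpq
  have hpq0' : p ≠ q' := fun h => by rw [h] at hpq'; exact iff_not_self hpq'
  intro Y hY hpY
  refine single_sub_thetaG_mem_of c T₀ (fun Y => T₀.1 \ Y.1 ⊆ {p, q, q'} ∧ (2 ≤ (T₀.1 \ Y.1).card → p ∈ T₀.1 \ Y.1)) hc2 L
    (fun Y hYU h2 => ?_) Y ⟨hY, hpY⟩
  obtain ⟨hYsub, hpY⟩ := hYU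
  have hpD : p ∈ T₀.1 \ Y.1 := hpY h2
  -- corners keep the class: deviation sets shrink, and `p` stays unless it is flipped (we never flip `p`)
  have hcorner : ∀ s ∈ T₀.1 \ Y.1, s ≠ p → T₀.1 \ (oflipCM c hc2 s Y).1 ⊆ {p, q, q'} ∧
      (2 ≤ (T₀.1 \ (oflipCM c hc2 s Y).1).card → p ∈ T₀.1 \ (oflipCM c hc2 s Y).1) := by
    intro s hs hsp
    rw [dev_oflip c hc2 (mem_sdiff.mp hs).1 (mem_sdiff.mp hs).2]
    exact ⟨(erase_subset _ _).trans hYsub, fun _ => mem_erase.mpr ⟨hsp.symm, hpD⟩⟩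
  have hcorner2 : ∀ s ∈ T₀.1 \ Y.1, ∀ s' ∈ T₀.1 \ Y.1, s ≠ s' → s ≠ p → s' ≠ p →
      T₀.1 \ (oflipCM c hc2 s (oflipCM c hc2 s' Y)).1 ⊆ {p, q, q'} ∧
      (2 ≤ (T₀.1 \ (oflipCM c hc2 s (oflipCM c hc2 s' Y)).1).card → p ∈ T₀.1 \ (oflipCM c hc2 s (oflipCM c hc2 s' Y)).1) := by
    intro s hs s' hs' hss' hsp hs'p
    have hs'' : s ∈ T₀.1 \ (oflipCM c hc2 s' Y).1 := by
      rw [dev_oflip c hc2 (mem_sdiff.mp hs').1 (mem_sdiff.mp hs').2]; exact mem_erase.mpr ⟨hss', hs⟩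
    obtain ⟨h1, h1p⟩ := hcorner s' hs' hs'p
    rw [dev_oflip c hc2 (mem_sdiff.mp hs'').1 (mem_sdiff.mp hs'').2]
    refine ⟨(erase_subset _ _).trans h1, fun hc' => mem_erase.mpr ⟨hsp.symm, h1p ?_⟩⟩
    exact le_trans hc' (card_erase_le)
  by_cases h3 : 3 ≤ (T₀.1 \ Y.1).card
  · -- the whole triple: `Y = X`, use the given face `(q, q')`
    have hle : ({p, q, q'} : Finset G).card ≤ (T₀.1 \ Y.1).card := le_trans card_le_three h3
    have hdev : T₀.1 \ Y.1 = {p, q, q'} := eq_of_subset_of_card_le hYsub hle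
    have hYX : Y = X := eq_of_dev_eq c T₀ (by rw [hdev, hX])
    subst hYX
    have hq : q ∈ T₀.1 \ Y.1 := by rw [hdev]; simp
    have hq' : q' ∈ T₀.1 \ Y.1 := by rw [hdev]; simp
    obtain ⟨k1, k1p⟩ := hcorner q hq hpq0.symm
    obtain ⟨k2, k2p⟩ := hcorner q' hq' hpq0'.symm
    obtain ⟨k3, k3p⟩ := hcorner2 q hq q' hq' hqq' hpq0.symm hpq0'.symm
    exact ⟨q, q', hq, hq', hqq', hface, ⟨k1, k1p⟩, ⟨k2, k2p⟩, ⟨k3, k3p⟩⟩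
  · -- a mixed pair `{p, r}`, `r ∈ {q, q'}`: unique nearest base change `T₀`
    have hcard : (T₀.1 \ Y.1).card = 2 := by omega
    obtain ⟨x, y, hxy, hD⟩ := card_eq_two.mp hcard
    -- `p ∈ D(Y) = {x, y}`; let `r` be the other element
    have hpxy : p = x ∨ p = y := by
      have h := hpD; rw [hD, mem_insert, mem_singleton] at h; exact h
    obtain ⟨r, hrD, hpr, hDpr⟩ : ∃ r : G, r ∈ T₀.1 \ Y.1 ∧ p ≠ r ∧ T₀.1 \ Y.1 = {p, r} := by
      rcases hpxy with rfl | rfl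
      · exact ⟨y, by rw [hD]; simp, hxy, hD⟩
      · exact ⟨x, by rw [hD]; simp, fun h => hxy h.symm, by rw [hD]; exact pair_comm x p⟩
    have hr0 : r ∈ T₀.1 := (mem_sdiff.mp hrD).1
    have hrqq : r = q ∨ r = q' := by
      have h := hYsub hrD
      rw [mem_insert, mem_insert, mem_singleton] at h
      rcases h with h | h | h
      · exact absurd h.symm hpr
      · exact Or.inl h
      · exact Or.inr h
    have hside : p ∈ T₁.1 ↔ r ∉ T₁.1 := by
      rcases hrqq with rfl | rfl
      · exact hpq
      · exact hpq'
    obtain ⟨hbp, huniq⟩ := unique_T₀_of_mixed_pair c hc2 hcen T₀ T₁ hbase m hn hH hm hp0 hr0 hpr hside Y hDpr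
    obtain ⟨s, s', hs, hs', hss', hmem⟩ := face_toward_T₀ c hc2 T₀ L hcover Y (by rw [hbp]) huniq
    -- corners of a pair have deviation sets of size ≤ 1: the `p`-clause is vacuous
    have hsmall : ∀ s ∈ T₀.1 \ Y.1, T₀.1 \ (oflipCM c hc2 s Y).1 ⊆ {p, q, q'} ∧
        (2 ≤ (T₀.1 \ (oflipCM c hc2 s Y).1).card → p ∈ T₀.1 \ (oflipCM c hc2 s Y).1) := by
      intro s hs
      rw [dev_oflip c hc2 (mem_sdiff.mp hs).1 (mem_sdiff.mp hs).2]
      refine ⟨(erase_subset _ _).trans hYsub, fun h2' => ?_⟩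
      exfalso
      have := card_erase_of_mem hs
      omega
    have hsmall2 : T₀.1 \ (oflipCM c hc2 s (oflipCM c hc2 s' Y)).1 ⊆ {p, q, q'} ∧
        (2 ≤ (T₀.1 \ (oflipCM c hc2 s (oflipCM c hc2 s' Y)).1).card → p ∈ T₀.1 \ (oflipCM c hc2 s (oflipCM c hc2 s' Y)).1) := by
      have hs'' : s ∈ T₀.1 \ (oflipCM c hc2 s' Y).1 := by
        rw [dev_oflip c hc2 (mem_sdiff.mp hs').1 (mem_sdiff.mp hs').2]; exact mem_erase.mpr ⟨hss', hs⟩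
      obtain ⟨h1, -⟩ := hsmall s' hs'
      rw [dev_oflip c hc2 (mem_sdiff.mp hs'').1 (mem_sdiff.mp hs'').2]
      refine ⟨(erase_subset _ _).trans h1, fun h2' => ?_⟩
      exfalso
      have e1 := card_erase_of_mem hs''
      have e2 : (T₀.1 \ (oflipCM c hc2 s' Y).1).card = (T₀.1 \ Y.1).card - 1 := by
        rw [dev_oflip c hc2 (mem_sdiff.mp hs').1 (mem_sdiff.mp hs').2, card_erase_of_mem hs']
      omega
    exact ⟨s, s', hs, hs', hss', hmem, hsmall s hs, hsmall s' hs', hsmall2⟩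

end Frame

end

end Summit.HodgeConjecture.CorCM.Census.CentralSquares
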